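import Literature.MathematicalPhysics.KineticTheory.LangevinChainKernelDensity
import Literature.MathematicalPhysics.KineticTheory.LangevinChainEnergyIdentity

/-!
# Energy window, part V-b1 — the second derivative of the pinned-chain drift grows at most like `√H`

Lineage `stmt-AtomisticToContinuum-9121` (`ExtensiveSnapshotIrreversibility`), K_fix half, leaf S3
`KernelTemperatureLipschitz`; record (G1*ᶜᶜ) ⟸ (SWM)ₐ ∧ (JMˣ)₁ ∧ (JMˣ)₂, (G1ℓ) ⟸ (SWM)_d ∧ (JM) ∧
(JMˣ)₁ ∧ (JMˣ)₂ (critic row 1107).  Cell decomp-a2c, lens «grading / quantitative ladder»,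
generation 80, part V «SkeletonSecondVariation» (the leaf (JMˣ)₂): V-a `…ForcedSecondVariation`
(generic second-variation equation) · V-b1 (this file, tree imports only) · V-b2
`…SkeletonSecondVariation` (pathwise bound) · V-c `…SkeletonSecondVariationMoments` ((JMˣ)₂ PROVED).

THIS FILE: S′a's drift-derivative bound `‖DY(x) v‖ ≤ (A₀ + A₁√H(x)) ‖v‖`
(`norm_fderiv_drift_apply_le`) ONE DERIVATIVE UP, for the pinned anharmonic chain
`Y = (pinnedChain ω₂ λ β γ).drift N` (pinning `ω₂ q²/2 + λ q⁴/4`, interaction `r²/2 + β r⁴/4`):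
* §1 the quadratic expansion of the potential Hessian along a line,
  `Hess_{ij}(q + t a) = Hess_{ij}(q) + t · hess3_{ij}(q, a) + t² · hessRem_{ij}(a)` (the third
  derivatives `U''' = 6λq`, `V''' = 6βr` are LINEAR), hence
  `DY(x + t a) b = DY(x) b + t · driftD2(x)[a] b + t² · driftR2[a] b` (`fderiv_drift_line`);
* §2 **the second derivative in closed form**, `D²Y(x)[a][b] = driftD2(x)[a] b =
  (0, −∑_j hess3_{ij}(q, a₁) b₁_j)` (`fderiv_fderiv_drift_apply`: chain rule along the line and
  uniqueness of the derivative of the quadratic);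
* §3 **the `√H` bound** `‖D²Y(x)[a][b]‖ ≤ B₁ √H(x) ‖a‖ ‖b‖`, `B₁ = N (6λ√(2/ω₂) + 12√2 N² β)`
  (`norm_fderiv_fderiv_drift_le`): `|q_i| ≤ √(2/ω₂) √H` from the pinning energy and
  `|q_{k+1} − q_k| ≤ √2 √H` from the bond energy (sup norms on phase space, as S′a).
No typeclass declarations, no new syntax, no options; no proof holes.  References: Carmona,
Stoch. Anal. Appl. 2007 §3 (polynomial drifts); CEHR 2018 §3
[cite: CuneoEckmannHairerReyBellet2018, §3]. [folklore]
-/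

noncomputable section

namespace Summit.AtomisticToContinuum.FouriersLaw.Theorems.ExtensiveSnapshotIrreversibility.EnergyWindow

open scoped Real
open scoped ContDiff
open Literature.MathematicalPhysics.KineticTheory.HeatConduction

/-! ## 1. The potential Hessian along a line -/

/-- The `t`-coefficient of `Hess_{ij}(q + t a)`: `6λ q_i a_i [i=j] +
∑_{l=k+1} 6β (q_l − q_k)(a_l − a_k) c^j_{kl} c^i_{kl}`. [folklore] -/
def hess3 (lam β : ℝ) (N : ℕ) (i j : Fin N) (q a : Fin N → ℝ) : ℝ :=
  6 * lam * (q i * a i) * (if i = j then 1 else 0) +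
    ∑ k : Fin N, ∑ l : Fin N, if l.val = k.val + 1 then
      6 * β * ((q l - q k) * (a l - a k)) *
        (((if l = j then 1 else 0) - (if k = j then 1 else 0)) *
          ((if l = i then 1 else 0) - (if k = i then 1 else 0))) else 0

/-- The `t²`-coefficient of `Hess_{ij}(q + t a)` (independent of `q`). [folklore] -/
def hessRem (lam β : ℝ) (N : ℕ) (i j : Fin N) (a : Fin N → ℝ) : ℝ :=
  3 * lam * a i ^ 2 * (if i = j then 1 else 0) +
    ∑ k : Fin N, ∑ l : Fin N, if l.val = k.val + 1 then
      3 * β * (a l - a k) ^ 2 *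
        (((if l = j then 1 else 0) - (if k = j then 1 else 0)) *
          ((if l = i then 1 else 0) - (if k = i then 1 else 0))) else 0

/-- `U''(y) = ω₂ + 3λ y²` for the pinning potential. [folklore] (dedup gate: public twin Literature.Barriers.AtomisticToContinuum.pinnedChain_deriv_deriv_U (MacroErgodicityHypothesis); kept PRIVATE here rather than importing the barrier file) -/
private theorem pinnedChain_deriv_deriv_U_apply (ω₂ lam β γ y : ℝ) :
    deriv (deriv (pinnedChain ω₂ lam β γ).U) y = ω₂ + 3 * lam * y ^ 2 := by
  have hd : deriv (pinnedChain ω₂ lam β γ).U = fun q => ω₂ * q + lam * q ^ 3 :=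
    funext (pinnedChain_deriv_U ω₂ lam β γ)
  rw [hd]
  have h := (hasDerivAt_const_mul ω₂ : HasDerivAt (fun q : ℝ => ω₂ * q) ω₂ y).fun_add
    ((hasDerivAt_pow 3 y).const_mul lam)
  rw [h.deriv]
  norm_num; ring

/-- **The Hessian along a line is an explicit quadratic in `t`**:
`Hess_{ij}(q + t a) = Hess_{ij}(q) + t · hess3_{ij}(q, a) + t² · hessRem_{ij}(a)`. [folklore] -/
theorem hessPotential_line (ω₂ lam β γ : ℝ) (N : ℕ) (i j : Fin N) (q a : Fin N → ℝ) (t : ℝ) :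
    (pinnedChain ω₂ lam β γ).hessPotential N i j (q + t • a) =
      (pinnedChain ω₂ lam β γ).hessPotential N i j q + t * hess3 lam β N i j q a +
        t ^ 2 * hessRem lam β N i j a := by
  unfold OscillatorChain.hessPotential hess3 hessRem
  simp only [pinnedChain_deriv_deriv_U_apply, pinnedChain_deriv_deriv_V, Pi.add_apply,
    Pi.smul_apply, smul_eq_mul]
  have hterm : ∀ k l : Fin N,
      (if l.val = k.val + 1 then
          (1 + 3 * β * (q l + t * a l - (q k + t * a k)) ^ 2) *
              ((if l = j then (1 : ℝ) else 0) - if k = j then 1 else 0) *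
            ((if l = i then (1 : ℝ) else 0) - if k = i then 1 else 0)
        else 0) =
        (if l.val = k.val + 1 then
            (1 + 3 * β * (q l - q k) ^ 2) *
                ((if l = j then (1 : ℝ) else 0) - if k = j then 1 else 0) *
              ((if l = i then (1 : ℝ) else 0) - if k = i then 1 else 0)
          else 0) +
          t * (if l.val = k.val + 1 then
            6 * β * ((q l - q k) * (a l - a k)) *
              (((if l = j then (1 : ℝ) else 0) - if k = j then 1 else 0) *
                ((if l = i then (1 : ℝ) else 0) - if k = i then 1 else 0)) else 0) +
          t ^ 2 * (if l.val = k.val + 1 then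
            3 * β * (a l - a k) ^ 2 *
              (((if l = j then (1 : ℝ) else 0) - if k = j then 1 else 0) *
                ((if l = i then (1 : ℝ) else 0) - if k = i then 1 else 0)) else 0) := by
    intro k l
    split_ifs <;> ring
  simp_rw [hterm, Finset.sum_add_distrib, ← Finset.mul_sum]
  ring

section Drift

variable {ω₂ lam β γ : ℝ} (N : ℕ)

/-- The second derivative of the drift in closed form (momentum block zero, position block
`−hess3 · b₁`): `driftD2(x)[a] b = (0, −∑_j hess3_{ij}(q, a₁) b₁_j)`. [folklore] -/
def driftD2 (lam β : ℝ) (N : ℕ) (x a b : PhaseSpace N) : PhaseSpace N :=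
  ((0 : Fin N → ℝ), fun i => -(∑ j, hess3 lam β N i j x.1 a.1 * b.1 j))

/-- The `t²`-coefficient of `DY(x + t a) b`. [folklore] -/
def driftR2 (lam β : ℝ) (N : ℕ) (a b : PhaseSpace N) : PhaseSpace N :=
  ((0 : Fin N → ℝ), fun i => -(∑ j, hessRem lam β N i j a.1 * b.1 j))

/-- **The drift derivative along a line is an explicit quadratic**:
`DY(x + t a) b = DY(x) b + t · driftD2(x)[a] b + t² · driftR2[a] b`. [folklore] -/
theorem fderiv_drift_line (ω₂ lam β γ : ℝ) (x a b : PhaseSpace N) (t : ℝ) :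
    fderiv ℝ ((pinnedChain ω₂ lam β γ).drift N) (x + t • a) b =
      fderiv ℝ ((pinnedChain ω₂ lam β γ).drift N) x b + t • driftD2 lam β N x a b +
        t ^ 2 • driftR2 lam β N a b := by
  have hU := pinnedChain_contDiff_U ω₂ lam β γ (n := ∞)
  have hV := pinnedChain_contDiff_V ω₂ lam β γ (n := ∞)
  rw [(pinnedChain ω₂ lam β γ).fderiv_drift_apply hU hV N (x + t • a) b,
    (pinnedChain ω₂ lam β γ).fderiv_drift_apply hU hV N x b]
  refine Prod.ext ?_ (funext fun i => ?_)
  · simp [driftD2, driftR2]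
  · simp only [driftD2, driftR2, Prod.fst_add, Prod.smul_fst, Prod.snd_add, Prod.smul_snd,
      Pi.add_apply, Pi.smul_apply, smul_eq_mul, hessPotential_line, add_mul,
      Finset.sum_add_distrib]
    simp only [mul_assoc, ← Finset.mul_sum]
    ring

/-- Derivative at `0` of a vector quadratic `t ↦ c₀ + t c₁ + t² c₂` is `c₁`. [folklore] -/
theorem hasDerivAt_quadratic_zero {F : Type*} [NormedAddCommGroup F] [NormedSpace ℝ F]
    (c₀ c₁ c₂ : F) : HasDerivAt (fun t : ℝ => c₀ + t • c₁ + t ^ 2 • c₂) c₁ 0 := by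
  have h1 : HasDerivAt (fun t : ℝ => c₀ + t • c₁) ((1 : ℝ) • c₁) 0 :=
    ((hasDerivAt_id' (x := (0 : ℝ))).smul_const c₁).const_add c₀
  have h2 : HasDerivAt (fun t : ℝ => t ^ 2 • c₂) ((((2 : ℕ) : ℝ) * (0 : ℝ) ^ (2 - 1)) • c₂) 0 :=
    (hasDerivAt_pow 2 (0 : ℝ)).smul_const c₂
  simpa using h1.fun_add h2

/-! ## 2. The second derivative of the drift in closed form -/

/-- **`D²Y(x)[a][b] = driftD2(x)[a] b`** for the pinned anharmonic chain: the curried second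
Fréchet derivative of the drift equals the explicit bilinear form of §1 (chain rule along the line
`t ↦ x + t a` and uniqueness of the derivative of the quadratic `fderiv_drift_line`).
[folklore] -/
theorem fderiv_fderiv_drift_apply (ω₂ lam β γ : ℝ) (x a b : PhaseSpace N) :
    fderiv ℝ (fderiv ℝ ((pinnedChain ω₂ lam β γ).drift N)) x a b = driftD2 lam β N x a b := by
  set Y := (pinnedChain ω₂ lam β γ).drift N with hY
  have hYs : ContDiff ℝ 2 Y := pinnedChain_contDiff_drift ω₂ lam β γ N (n := 2)
  have hY'd : Differentiable ℝ (fderiv ℝ Y) :=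
    (hYs.fderiv_right (m := 1) (by norm_num)).differentiable (by norm_num)
  have hdiff : DifferentiableAt ℝ (fun y => fderiv ℝ Y y b) x :=
    (hY'd x).clm_apply (differentiableAt_const b)
  -- `D²Y(x)[a][b] = D(y ↦ DY(y) b)(x)[a]`
  have h1 : fderiv ℝ (fun y => fderiv ℝ Y y b) x a = fderiv ℝ (fderiv ℝ Y) x a b := by
    rw [fderiv_clm_apply (hY'd x) (differentiableAt_const b)]
    simp
  -- chain rule along the line
  have hline : HasDerivAt (fun t : ℝ => x + t • a) a 0 := by
    simpa using ((hasDerivAt_id' (x := (0 : ℝ))).smul_const a).const_add x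
  have hcomp : HasDerivAt (fun t : ℝ => fderiv ℝ Y (x + t • a) b)
      (fderiv ℝ (fun y => fderiv ℝ Y y b) x a) 0 := by
    have h := HasFDerivAt.comp_hasDerivAt_of_eq (hl := hdiff.hasFDerivAt) (hf := hline)
      (hy := by simp)
    exact h
  -- the same curve is the explicit quadratic
  have hquad : HasDerivAt (fun t : ℝ => fderiv ℝ Y (x + t • a) b) (driftD2 lam β N x a b) 0 := by
    have hfun : (fun t : ℝ => fderiv ℝ Y (x + t • a) b) = fun t : ℝ =>
        fderiv ℝ Y x b + t • driftD2 lam β N x a b + t ^ 2 • driftR2 lam β N a b :=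
      funext fun t => fderiv_drift_line N ω₂ lam β γ x a b t
    rw [hfun]
    exact hasDerivAt_quadratic_zero _ _ _
  rw [← h1]
  exact hcomp.unique hquad

/-! ## 3. The `√H` bound -/

/-- The `√H` coefficient `B₁ = N (6λ √(2/ω₂) + N² · 12 √2 β)` of the second-derivative bound.
[folklore] -/
def driftB₁ (ω₂ lam β : ℝ) (N : ℕ) : ℝ := N * (6 * lam * √(2 / ω₂) + N * N * (12 * √2 * β))

/-- `0 ≤ B₁` for `λ, β ≥ 0`. [folklore] -/
theorem driftB₁_nonneg {ω₂ lam β : ℝ} (hl : 0 ≤ lam) (hβ : 0 ≤ β) (N : ℕ) :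
    0 ≤ driftB₁ ω₂ lam β N := by
  unfold driftB₁; positivity

variable (hω : 0 < ω₂) (hl : 0 ≤ lam) (hβ : 0 ≤ β)

include hω hl hβ in
/-- Positions are controlled by the pinning energy: `|q_i| ≤ √(2/ω₂) √H`. [folklore] -/
theorem abs_pos_le_sqrt_hamiltonian (x : PhaseSpace N) (i : Fin N) :
    |x.1 i| ≤ √(2 / ω₂) * √((pinnedChain ω₂ lam β γ).hamiltonian N x) := by
  have h := pinnedChain_U_le_hamiltonian hω.le hl hβ γ N x i
  have h4 : 0 ≤ lam * x.1 i ^ 4 / 4 := by positivity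
  have hsq : x.1 i ^ 2 ≤ 2 / ω₂ * (pinnedChain ω₂ lam β γ).hamiltonian N x := by
    rw [div_mul_eq_mul_div, le_div_iff₀ hω]
    nlinarith
  rw [← Real.sqrt_mul (by positivity : (0 : ℝ) ≤ 2 / ω₂)]
  exact Real.abs_le_sqrt hsq

include hω hl hβ in
/-- Bonds are controlled by the interaction energy: `|q_l − q_k| ≤ √2 √H` for `l = k + 1`.
[folklore] -/
theorem abs_bond_le_sqrt_hamiltonian (x : PhaseSpace N) {k l : Fin N} (hlk : l.val = k.val + 1) :
    |x.1 l - x.1 k| ≤ √2 * √((pinnedChain ω₂ lam β γ).hamiltonian N x) := by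
  have h := pinnedChain_bond_le_hamiltonian hω.le hl hβ γ N x hlk
  have h4 : 0 ≤ β * (x.1 l - x.1 k) ^ 4 / 4 := by positivity
  have hsq : (x.1 l - x.1 k) ^ 2 ≤ 2 * (pinnedChain ω₂ lam β γ).hamiltonian N x := by nlinarith
  rw [← Real.sqrt_mul (by norm_num : (0 : ℝ) ≤ 2)]
  exact Real.abs_le_sqrt hsq

include hω hl hβ in
/-- Entrywise bound: `|hess3_{ij}(q, a)| ≤ (6λ√(2/ω₂) + N² · 12√2 β) √H(q, p) ‖a‖`. [folklore] -/
theorem abs_hess3_le (x : PhaseSpace N) (a : Fin N → ℝ) (i j : Fin N) :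
    |hess3 lam β N i j x.1 a| ≤ (6 * lam * √(2 / ω₂) + (N : ℝ) * N * (12 * √2 * β)) *
      √((pinnedChain ω₂ lam β γ).hamiltonian N x) * ‖a‖ := by
  set H := (pinnedChain ω₂ lam β γ).hamiltonian N x with hH
  have hS0 : 0 ≤ √H := Real.sqrt_nonneg _
  have ha : ∀ i, |a i| ≤ ‖a‖ := fun i => by rw [← Real.norm_eq_abs]; exact norm_le_pi_norm a i
  have hind : ∀ (p p' : Prop) [Decidable p] [Decidable p'],
      |((if p then (1 : ℝ) else 0) - (if p' then 1 else 0))| ≤ 1 := by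
    intro p p' _ _; split_ifs <;> norm_num
  -- pinning term
  have h1 : |6 * lam * (x.1 i * a i) * (if i = j then (1 : ℝ) else 0)| ≤
      6 * lam * √(2 / ω₂) * √H * ‖a‖ := by
    have hι : |(if i = j then (1 : ℝ) else 0)| ≤ 1 := by split_ifs <;> norm_num
    simp only [abs_mul]
    rw [abs_of_pos (by norm_num : (0 : ℝ) < 6), abs_of_nonneg hl]
    have hq := abs_pos_le_sqrt_hamiltonian N hω hl hβ (γ := γ) x i
    have hqa : |x.1 i| * |a i| ≤ √(2 / ω₂) * √H * ‖a‖ :=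
      mul_le_mul hq (ha i) (abs_nonneg _) (mul_nonneg (Real.sqrt_nonneg _) hS0)
    calc 6 * lam * (|x.1 i| * |a i|) * |(if i = j then (1 : ℝ) else 0)|
        ≤ 6 * lam * (√(2 / ω₂) * √H * ‖a‖) * 1 :=
          mul_le_mul (mul_le_mul_of_nonneg_left hqa (by positivity)) hι (abs_nonneg _)
            (by positivity)
      _ = 6 * lam * √(2 / ω₂) * √H * ‖a‖ := by ring
  -- bond terms
  have h2 : ∀ k l : Fin N,
      |(if l.val = k.val + 1 then
          6 * β * ((x.1 l - x.1 k) * (a l - a k)) *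
            (((if l = j then (1 : ℝ) else 0) - (if k = j then 1 else 0)) *
              ((if l = i then (1 : ℝ) else 0) - (if k = i then 1 else 0))) else 0)| ≤
        12 * √2 * β * √H * ‖a‖ := by
    intro k l
    have hc : (0 : ℝ) ≤ 12 * √2 * β * √H * ‖a‖ := by positivity
    by_cases hlk : l.val = k.val + 1
    · rw [if_pos hlk]
      have hb := abs_bond_le_sqrt_hamiltonian N hω hl hβ (γ := γ) x hlk
      have hd : |a l - a k| ≤ 2 * ‖a‖ := by
        calc |a l - a k| ≤ |a l| + |a k| := abs_sub _ _
          _ ≤ ‖a‖ + ‖a‖ := add_le_add (ha l) (ha k)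
          _ = 2 * ‖a‖ := by ring
      have hcc := mul_le_mul (hind (l = j) (k = j)) (hind (l = i) (k = i)) (abs_nonneg _)
        zero_le_one
      simp only [abs_mul]
      rw [abs_of_pos (by norm_num : (0 : ℝ) < 6), abs_of_nonneg hβ]
      have hprod : |x.1 l - x.1 k| * |a l - a k| ≤ √2 * √H * (2 * ‖a‖) :=
        mul_le_mul hb hd (abs_nonneg _) (mul_nonneg (Real.sqrt_nonneg _) hS0)
      calc 6 * β * (|x.1 l - x.1 k| * |a l - a k|) *
            (|((if l = j then (1 : ℝ) else 0) - if k = j then 1 else 0)| *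
              |((if l = i then (1 : ℝ) else 0) - if k = i then 1 else 0)|)
          ≤ 6 * β * (√2 * √H * (2 * ‖a‖)) * (1 * 1) :=
            mul_le_mul (mul_le_mul_of_nonneg_left hprod (by positivity)) hcc
              (mul_nonneg (abs_nonneg _) (abs_nonneg _)) (by positivity)
        _ = 12 * √2 * β * √H * ‖a‖ := by ring
    · rw [if_neg hlk, abs_zero]; exact hc
  unfold hess3
  refine (abs_add_le _ _).trans ?_
  have hsum : |∑ k : Fin N, ∑ l : Fin N, (if l.val = k.val + 1 then
      6 * β * ((x.1 l - x.1 k) * (a l - a k)) *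
        (((if l = j then (1 : ℝ) else 0) - (if k = j then 1 else 0)) *
          ((if l = i then (1 : ℝ) else 0) - (if k = i then 1 else 0))) else 0)| ≤
      (N : ℝ) * ((N : ℝ) * (12 * √2 * β * √H * ‖a‖)) := by
    refine (Finset.abs_sum_le_sum_abs _ _).trans ?_
    calc ∑ k : Fin N, |∑ l : Fin N, (if l.val = k.val + 1 then
            6 * β * ((x.1 l - x.1 k) * (a l - a k)) *
              (((if l = j then (1 : ℝ) else 0) - (if k = j then 1 else 0)) *
                ((if l = i then (1 : ℝ) else 0) - (if k = i then 1 else 0))) else 0)|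
        ≤ ∑ k : Fin N, ∑ l : Fin N, 12 * √2 * β * √H * ‖a‖ :=
          Finset.sum_le_sum fun k _ =>
            (Finset.abs_sum_le_sum_abs _ _).trans (Finset.sum_le_sum fun l _ => h2 k l)
      _ = (N : ℝ) * ((N : ℝ) * (12 * √2 * β * √H * ‖a‖)) := by
          simp only [Finset.sum_const, Finset.card_univ, Fintype.card_fin, nsmul_eq_mul]
  refine (add_le_add h1 hsum).trans (le_of_eq ?_)
  ring

include hω hl hβ in
/-- **The second derivative of the drift grows at most like `√H`** (sup norms on phase space):
`‖D²Y(x)[a][b]‖ ≤ B₁ √H(x) ‖a‖ ‖b‖`. [folklore] -/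
theorem norm_fderiv_fderiv_drift_le (x a b : PhaseSpace N) :
    ‖fderiv ℝ (fderiv ℝ ((pinnedChain ω₂ lam β γ).drift N)) x a b‖ ≤
      driftB₁ ω₂ lam β N * √((pinnedChain ω₂ lam β γ).hamiltonian N x) * ‖a‖ * ‖b‖ := by
  set H := (pinnedChain ω₂ lam β γ).hamiltonian N x with hH
  set K := (6 * lam * √(2 / ω₂) + (N : ℝ) * N * (12 * √2 * β)) * √H * ‖a‖ with hK
  have hK0 : 0 ≤ K := by rw [hK]; positivity
  have hKij : ∀ i j, |hess3 lam β N i j x.1 a.1| ≤ K := fun i j =>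
    (abs_hess3_le N hω hl hβ (γ := γ) x a.1 i j).trans
      (mul_le_mul_of_nonneg_left (norm_fst_le a) (by positivity))
  have hb1 : ∀ j, |b.1 j| ≤ ‖b‖ := fun j => by
    rw [← Real.norm_eq_abs]; exact (norm_le_pi_norm _ j).trans (norm_fst_le b)
  have hB : driftB₁ ω₂ lam β N * √H * ‖a‖ * ‖b‖ = (N : ℝ) * (K * ‖b‖) := by
    rw [driftB₁, hK]; ring
  rw [fderiv_fderiv_drift_apply N ω₂ lam β γ x a b, driftD2, Prod.norm_mk, norm_zero,
    max_eq_right (norm_nonneg _), hB]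
  refine (pi_norm_le_iff_of_nonneg (by positivity)).2 fun i => ?_
  rw [Real.norm_eq_abs, abs_neg]
  refine (Finset.abs_sum_le_sum_abs _ _).trans ?_
  calc ∑ j, |hess3 lam β N i j x.1 a.1 * b.1 j| ≤ ∑ _j : Fin N, K * ‖b‖ :=
        Finset.sum_le_sum fun j _ => by
          rw [abs_mul]; exact mul_le_mul (hKij i j) (hb1 j) (abs_nonneg _) hK0
    _ = (N : ℝ) * (K * ‖b‖) := by
        simp only [Finset.sum_const, Finset.card_univ, Fintype.card_fin, nsmul_eq_mul]

end Drift

end Summit.AtomisticToContinuum.FouriersLaw.Theorems.ExtensiveSnapshotIrreversibility.EnergyWindow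

end
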